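import Summits.ResolutionOfSingularities.KangarooAtlas.MizutaniLayer
import Summits.ResolutionOfSingularities.KangarooAtlas.MizutaniDigitLemma
import Mathlib.Data.Nat.Choose.Lucas
import HarnessLib

/-!
# Mizutani's conjecture `m(e) = 2p^e − 1` — elementary moves of exponent vectors (redistribution)

Cell topic `Summits/ResolutionOfSingularities/KangarooAtlas` (pub-rosobs); namespace
`Summit.ResolutionOfSingularities.KangarooAtlas.Mizutani`.  Part of the Lean transcription of the
in-house note MIZUTANI-PROOF-g59 (AI-written, AI-audited; *AI review is weaker than expert review*; not a
resolution theorem).  Pure combinatorics of exponent vectors `M : ι →₀ ℕ` in the box `[0, q−1]^ι`,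
`q = p^e` (encloser-1 ARCH-e1 §3; the note's §5 REDISTRIBUTION and §7 (L4), (L5)).

* `move j i u M = M − u e_j + u e_i` — an ELEMENTARY MOVE (transfer `u` from coordinate `j` to `i`);
  `LegalMove p q M j i u` — `j ≠ i`, `p ∤ C(M_j, u)` (i.e. `u ≤_d M_j` digitwise, Lucas) and `M_i + u < q`.
  In the algebra (the SPREAD step) a generic elementary substitution `t_j ↦ t_j + β t_i` turns the
  support `S` into exactly `S ∪ {legal moves of points of S}`; a MOVE-CLOSED set (`MoveClosed`) is the
  end of that process (the note's `Red(S)`).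
* `(L5)`: a legal move preserves `|M|` and the box and never decreases `floor`
  (`degree_move`, `inBox_move`, `floorSum_le_floorSum_move`), so genuine points of a move-closed set come
  with controlled excess.
* `(L4)` `exists_reduced`: in a move-closed set, from a genuine `G` one reaches the REDUCED point
  `P⁰ = (pΦ + r_a at the accumulator a; r_j = G_j mod p elsewhere)` with the same degree and floor.
* `exists_pour`: POURING units out of a coordinate holding a single digit (`< p`) into coordinates with
  room, according to a prescribed allocation — the mechanism of (β) (§6) and (L3) (§7).
* `exists_alloc`: a prescribed total below the capacities can be allocated (the note's transportation remark).

References: [Mizutani1973HironakaGroupSchemes] (Remark 2.10; in-house proof §5–§7); Lucas via Mathlib.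
-/

open MvPolynomial

namespace Summit.ResolutionOfSingularities.KangarooAtlas.Mizutani

/-! ## One-step Lucas consequences -/

section Lucas

variable {p : ℕ} [hp : Fact p.Prime]

/-- One-step Lucas, divisibility form: `p ∤ C(n,k) ⟺ p ∤ C(n % p, k % p) ∧ p ∤ C(n/p, k/p)`.
[folklore] -/
theorem not_dvd_choose_iff (n k : ℕ) :
    ¬ p ∣ n.choose k ↔ ¬ p ∣ (n % p).choose (k % p) ∧ ¬ p ∣ (n / p).choose (k / p) := by
  have h := (Choose.choose_modEq_choose_mod_mul_choose_div_nat (n := n) (k := k) (p := p))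
  rw [(Nat.ModEq.dvd_iff h (dvd_refl p)), Nat.Prime.dvd_mul hp.out]
  tauto

/-- `p ∤ C(n,k)` forces no borrow in the units digit: `k % p ≤ n % p`. [folklore] -/
theorem mod_le_mod_of_not_dvd_choose {n k : ℕ} (h : ¬ p ∣ n.choose k) : k % p ≤ n % p := by
  have h1 := ((not_dvd_choose_iff n k).mp h).1
  by_contra hlt
  push Not at hlt
  exact h1 (by rw [Nat.choose_eq_zero_of_lt hlt]; exact dvd_zero p)

omit hp in
/-- `p ∤ C(n,k)` forces `k ≤ n`. [folklore] -/
theorem le_of_not_dvd_choose {n k : ℕ} (h : ¬ p ∣ n.choose k) : k ≤ n := by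
  by_contra hlt
  push Not at hlt
  exact h (by rw [Nat.choose_eq_zero_of_lt hlt]; exact dvd_zero p)

/-- A single digit dominates everything below it: `n < p`, `k ≤ n` ⟹ `p ∤ C(n,k)`. [folklore] -/
theorem not_dvd_choose_of_lt_prime {n k : ℕ} (hn : n < p) (hk : k ≤ n) : ¬ p ∣ n.choose k :=
  DigitLemma.not_dvd_choose_of_lt hp.out hn hk

/-- Removing the units digit is legal: `p ∤ C(n, p·(n/p))`. [folklore] -/
theorem not_dvd_choose_mul_div (n : ℕ) : ¬ p ∣ n.choose (p * (n / p)) := by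
  rw [not_dvd_choose_iff]
  have hp0 : 0 < p := hp.out.pos
  refine ⟨?_, ?_⟩
  · rw [Nat.mul_mod_right, Nat.choose_zero_right]
    exact hp.out.not_dvd_one
  · rw [Nat.mul_div_cancel_left _ hp0, Nat.choose_self]
    exact hp.out.not_dvd_one

end Lucas

/-! ## Elementary moves -/

section Moves

variable {ι : Type*}

/-- **Elementary move**: transfer `u` units from coordinate `j` to coordinate `i`
(`M ↦ M − u e_j + u e_i`; MIZUTANI-PROOF-g59 §5 REDISTRIBUTION, one digit packet at a time).
[cite: Mizutani1973HironakaGroupSchemes, Remark 2.10 (in-house proof §5, Redist)] -/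
noncomputable def move (j i : ι) (u : ℕ) (M : ι →₀ ℕ) : ι →₀ ℕ :=
  M - Finsupp.single j u + Finsupp.single i u

/-- **Legal move** in the box `[0,q−1]^ι`, base `p`: `j ≠ i`, `p ∤ C(M_j,u)` (`u ≤_d M_j`, Lucas) and
`M_i + u < q`. [cite: Mizutani1973HironakaGroupSchemes, Remark 2.10 (in-house proof §5, Redist ∩ Box)] -/
structure LegalMove (p q : ℕ) (M : ι →₀ ℕ) (j i : ι) (u : ℕ) : Prop where
  /-- source and target differ -/
  ne : j ≠ i
  /-- digitwise domination `u ≤_d M_j` in Lucas form -/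
  not_dvd : ¬ p ∣ (M j).choose u
  /-- the target coordinate stays in the box -/
  lt : M i + u < q

/-- A **move-closed** set of exponent vectors (the note's `Red(S)` after generic spreading).
[cite: Mizutani1973HironakaGroupSchemes, Remark 2.10 (in-house proof §5 Thm D″, supp = Red(S))] -/
def MoveClosed (p q : ℕ) (S : Finset (ι →₀ ℕ)) : Prop :=
  ∀ M ∈ S, ∀ (j i : ι) (u : ℕ), LegalMove p q M j i u → move j i u M ∈ S

variable {p q : ℕ}

/-- The source coordinate after a move. [folklore] -/
theorem move_apply_source {j i : ι} (hji : j ≠ i) (u : ℕ) (M : ι →₀ ℕ) :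
    move j i u M j = M j - u := by
  simp [move, hji]

/-- The target coordinate after a move. [folklore] -/
theorem move_apply_target {j i : ι} (hji : j ≠ i) (u : ℕ) (M : ι →₀ ℕ) :
    move j i u M i = M i + u := by
  simp [move, hji]

/-- The other coordinates are unchanged by a move. [folklore] -/
theorem move_apply_other {j i l : ι} (hlj : l ≠ j) (hli : l ≠ i) (u : ℕ) (M : ι →₀ ℕ) :
    move j i u M l = M l := by
  simp [move, hlj.symm, hli.symm]

variable [DecidableEq ι]

/-- Uniform description of the coordinates after a move. [folklore] -/
theorem move_apply {j i : ι} (hji : j ≠ i) (u : ℕ) (M : ι →₀ ℕ) (l : ι) :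
    move j i u M l = if l = j then M j - u else if l = i then M i + u else M l := by
  split_ifs with h1 h2
  · subst h1; exact move_apply_source hji u M
  · subst h2; exact move_apply_target hji u M
  · exact move_apply_other h1 h2 u M

variable [Fintype ι]

/-- Splitting a sum over all coordinates at two distinct coordinates. [folklore] -/
theorem sum_eq_add_add_sum_erase (f : ι → ℕ) {j i : ι} (hji : j ≠ i) :
    ∑ l, f l = f j + f i + ∑ l ∈ (Finset.univ.erase j).erase i, f l := by
  rw [← Finset.add_sum_erase _ _ (Finset.mem_univ j)]
  have hi : i ∈ Finset.univ.erase j := Finset.mem_erase.mpr ⟨hji.symm, Finset.mem_univ i⟩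
  rw [← Finset.add_sum_erase _ _ hi, add_assoc]

/-- **Exact bookkeeping of a move** for any coordinatewise statistic `φ`:
`Σ φ(move M) + φ(M_j) + φ(M_i) = Σ φ(M) + φ(M_j − u) + φ(M_i + u)`. [folklore] -/
theorem sum_move_add (φ : ℕ → ℕ) {j i : ι} (hji : j ≠ i) (u : ℕ) (M : ι →₀ ℕ) :
    ∑ l, φ (move j i u M l) + φ (M j) + φ (M i) = ∑ l, φ (M l) + φ (M j - u) + φ (M i + u) := by
  rw [sum_eq_add_add_sum_erase (fun l => φ (move j i u M l)) hji,
    sum_eq_add_add_sum_erase (fun l => φ (M l)) hji, move_apply_source hji, move_apply_target hji]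
  have hrest : ∑ x ∈ (Finset.univ.erase j).erase i, φ (move j i u M x) =
      ∑ x ∈ (Finset.univ.erase j).erase i, φ (M x) := by
    refine Finset.sum_congr rfl fun l hl => ?_
    have h1 : l ≠ i := (Finset.mem_erase.mp hl).1
    have h2 : l ≠ j := (Finset.mem_erase.mp (Finset.mem_erase.mp hl).2).1
    rw [move_apply_other h2 h1 u M]
  rw [hrest]
  ring

/-- **(L5), degree**: a move with `u ≤ M_j` preserves `|M|`.
[cite: Mizutani1973HironakaGroupSchemes, Remark 2.10 (in-house proof §7 (L5))] -/
theorem degree_move {j i : ι} (hji : j ≠ i) {u : ℕ} {M : ι →₀ ℕ} (hu : u ≤ M j) :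
    (move j i u M).degree = M.degree := by
  rw [Finsupp.degree_eq_sum, Finsupp.degree_eq_sum]
  have h := sum_move_add id hji u M
  simp only [id] at h
  omega

/-- **Floor bookkeeping of a move**: `floor(move M) + ⌊M_j/p⌋ + ⌊M_i/p⌋ = floor(M) + ⌊(M_j−u)/p⌋ + ⌊(M_i+u)/p⌋`.
[folklore] -/
theorem floorSum_move_add {j i : ι} (hji : j ≠ i) (u : ℕ) (M : ι →₀ ℕ) :
    floorSum p (move j i u M) + M j / p + M i / p = floorSum p M + (M j - u) / p + (M i + u) / p := by
  rw [floorSum_eq_sum, floorSum_eq_sum]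
  exact sum_move_add (fun n => n / p) hji u M

omit [Fintype ι] in
/-- **(L5), box**: a legal move stays in the box.
[cite: Mizutani1973HironakaGroupSchemes, Remark 2.10 (in-house proof §7 (L5))] -/
theorem inBox_move {M : ι →₀ ℕ} (hM : InBox q M) {j i : ι} {u : ℕ} (h : LegalMove p q M j i u) :
    InBox q (move j i u M) := by
  intro l
  rw [move_apply h.ne]
  split_ifs with h1 h2
  · exact lt_of_le_of_lt (Nat.sub_le _ _) (hM j)
  · exact h.lt
  · exact hM l

/-- **(L5), floor** (prime `p`): a legal move never decreases `floor(M) = Σ ⌊M_l/p⌋` — the units digit of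
`u` is at most that of `M_j` (Lucas), so no borrow occurs at the source.
[cite: Mizutani1973HironakaGroupSchemes, Remark 2.10 (in-house proof §7 (L5))] -/
theorem floorSum_le_floorSum_move [Fact p.Prime] {M : ι →₀ ℕ} {j i : ι} {u : ℕ}
    (h : LegalMove p q M j i u) : floorSum p M ≤ floorSum p (move j i u M) := by
  have hp : 0 < p := (Fact.out : p.Prime).pos
  have hu : u ≤ M j := le_of_not_dvd_choose h.not_dvd
  have hmod : u % p ≤ M j % p := mod_le_mod_of_not_dvd_choose h.not_dvd
  have hbook := floorSum_move_add (p := p) h.ne u M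
  -- source: no borrow
  have h1 : (M j - u) / p = M j / p - u / p := by
    have hj := Nat.div_add_mod (M j) p
    have huu := Nat.div_add_mod u p
    have hdiv : u / p ≤ M j / p := Nat.div_le_div_right hu
    have : M j - u = p * (M j / p - u / p) + (M j % p - u % p) := by
      zify [hu, hmod, hdiv] at hj huu ⊢
      linear_combination huu - hj
    rw [this, Nat.mul_add_div hp, Nat.div_eq_of_lt (lt_of_le_of_lt (Nat.sub_le _ _) (Nat.mod_lt _ hp)),
      Nat.add_zero]
  -- target: gains at least `u / p`
  have h2 : M i / p + u / p ≤ (M i + u) / p := Nat.add_div_le_add_div _ _ _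
  have h3 : u / p ≤ M j / p := Nat.div_le_div_right hu
  omega

/-- **Floor of a move of a multiple of `p`** out of the higher digits: `floor` is unchanged. [folklore] -/
theorem floorSum_move_mul [Fact p.Prime] {M : ι →₀ ℕ} {j i : ι} (hji : j ≠ i) {f : ℕ} (hf : f ≤ M j / p) :
    floorSum p (move j i (p * f) M) = floorSum p M := by
  have hp : 0 < p := (Fact.out : p.Prime).pos
  have hbook := floorSum_move_add (p := p) hji (p * f) M
  have h1 : (M j - p * f) / p = M j / p - f := Nat.sub_mul_div _ _ _
  have h2 : (M i + p * f) / p = M i / p + f := by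
    rw [Nat.add_mul_div_left _ _ hp]
  omega

/-- **Floor of a pour of a single digit**: moving `u ≤ M_j < p` changes `floor` only at the target. [folklore] -/
theorem floorSum_move_small [Fact p.Prime] {M : ι →₀ ℕ} {j i : ι} (hji : j ≠ i) {u : ℕ} (hMj : M j < p) :
    floorSum p (move j i u M) + M i / p = floorSum p M + (M i + u) / p := by
  have hbook := floorSum_move_add (p := p) hji u M
  have h1 : (M j - u) / p = 0 := Nat.div_eq_of_lt (lt_of_le_of_lt (Nat.sub_le _ _) hMj)
  have h0 : M j / p = 0 := Nat.div_eq_of_lt hMj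
  omega

end Moves

/-! ## Allocation, pouring, reduction -/

section Pour

variable {ι : Type*} [DecidableEq ι]

/-- **Allocation** (the note's "transportation problem with equal margins", §6 (β)): a total `y` not
exceeding the capacities `Σ_{j ∈ J} c_j` can be allocated as `Σ_{j ∈ J} t_j` with `t ≤ c`, `t = 0` off `J`.
[folklore] -/
theorem exists_alloc (c : ι → ℕ) (J : Finset ι) :
    ∀ y, y ≤ ∑ j ∈ J, c j →
      ∃ t : ι → ℕ, (∀ j, t j ≤ c j) ∧ (∀ j, j ∉ J → t j = 0) ∧ ∑ j ∈ J, t j = y := by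
  induction J using Finset.induction_on with
  | empty =>
    intro y hy
    refine ⟨fun _ => 0, fun _ => Nat.zero_le _, fun _ _ => rfl, ?_⟩
    simp only [Finset.sum_empty] at hy ⊢
    omega
  | insert a J ha ih =>
    intro y hy
    rw [Finset.sum_insert ha] at hy
    by_cases hy' : y ≤ ∑ j ∈ J, c j
    · obtain ⟨t, ht, ht0, hts⟩ := ih y hy'
      refine ⟨t, ht, fun j hj => ht0 j fun h => hj (Finset.mem_insert_of_mem h), ?_⟩
      rw [Finset.sum_insert ha, ht0 a ha, hts, zero_add]
    · push Not at hy'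
      obtain ⟨t, ht, ht0, hts⟩ := ih (∑ j ∈ J, c j) le_rfl
      refine ⟨Function.update t a (y - ∑ j ∈ J, c j), fun j => ?_, fun j hj => ?_, ?_⟩
      · rcases eq_or_ne j a with rfl | hja
        · rw [Function.update_self]; omega
        · rw [Function.update_of_ne hja]; exact ht j
      · rw [Function.update_of_ne (fun h => hj (by rw [h]; exact Finset.mem_insert_self a J))]
        exact ht0 j fun h => hj (Finset.mem_insert_of_mem h)
      · rw [Finset.sum_insert ha, Function.update_self,
          Finset.sum_congr rfl fun j hj => Function.update_of_ne (ne_of_mem_of_not_mem hj ha) _ _, hts]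
        omega

variable {p q : ℕ} [Fact p.Prime] [Fintype ι]

/-- **Pouring** (mechanism of (β), §6, and (L3), §7): in a move-closed set, from `P` whose coordinate `z`
holds a single digit (`P_z < p`), an allocation `t` on `J ∌ z` with `Σ_J t ≤ P_z` and room
`P_j + t_j < q` can be poured out of `z`; the floor changes only at the targets.
[cite: Mizutani1973HironakaGroupSchemes, Remark 2.10 (in-house proof §6 (β), §7 (L3))] -/
theorem exists_pour {S : Finset (ι →₀ ℕ)} (hS : MoveClosed p q S) (z : ι) (t : ι → ℕ) :
    ∀ J : Finset ι, z ∉ J → ∀ P ∈ S, P z < p → ∑ j ∈ J, t j ≤ P z → (∀ j ∈ J, P j + t j < q) →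
      ∃ P' ∈ S, P' z = P z - ∑ j ∈ J, t j ∧ (∀ j ∈ J, P' j = P j + t j) ∧
        (∀ l, l ≠ z → l ∉ J → P' l = P l) ∧ P'.degree = P.degree ∧
        floorSum p P' + ∑ j ∈ J, P j / p = floorSum p P + ∑ j ∈ J, (P j + t j) / p := by
  intro J
  induction J using Finset.induction_on with
  | empty =>
    intro _ P hP _ _ _
    exact ⟨P, hP, by simp, by simp, fun l _ _ => rfl, rfl, by simp⟩
  | insert a J ha ih =>
    intro hzJ P hP hPz hsum hroom
    rw [Finset.sum_insert ha] at hsum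
    have haz : z ≠ a := fun h => hzJ (h ▸ Finset.mem_insert_self a J)
    have hzJ' : z ∉ J := fun h => hzJ (Finset.mem_insert_of_mem h)
    -- move `t a` from `z` to `a`
    have hleg : LegalMove p q P z a (t a) :=
      ⟨haz, not_dvd_choose_of_lt_prime hPz (by omega), hroom a (Finset.mem_insert_self a J)⟩
    set P₁ := move z a (t a) P with hP₁
    have hP₁S : P₁ ∈ S := hS P hP z a (t a) hleg
    have hz₁ : P₁ z = P z - t a := move_apply_source haz _ _
    have ha₁ : P₁ a = P a + t a := move_apply_target haz _ _
    have hoth₁ : ∀ l, l ≠ z → l ≠ a → P₁ l = P l := fun l h1 h2 => move_apply_other h1 h2 _ _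
    have hJ₁ : ∀ j ∈ J, P₁ j = P j := fun j hj =>
      hoth₁ j (fun h => hzJ' (h ▸ hj)) (fun h => ha (h ▸ hj))
    obtain ⟨P', hP'S, hz', hJ', hoth', hdeg', hfl'⟩ := ih hzJ' P₁ hP₁S (by rw [hz₁]; omega)
      (by rw [hz₁]; omega) (fun j hj => by rw [hJ₁ j hj]; exact hroom j (Finset.mem_insert_of_mem hj))
    refine ⟨P', hP'S, ?_, ?_, ?_, ?_, ?_⟩
    · rw [hz', hz₁, Finset.sum_insert ha]; omega
    · intro j hj
      rcases Finset.mem_insert.mp hj with rfl | hj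
      · rw [hoth' j haz.symm ha, ha₁]
      · rw [hJ' j hj, hJ₁ j hj]
    · intro l hlz hl
      rw [hoth' l hlz (fun h => hl (Finset.mem_insert_of_mem h)),
        hoth₁ l hlz (fun h => hl (h ▸ Finset.mem_insert_self a J))]
    · rw [hdeg', hP₁, degree_move haz (by omega : t a ≤ P z)]
    · have hfl₁ := floorSum_move_small (p := p) (i := a) haz (u := t a) hPz
      rw [Finset.sum_insert ha, Finset.sum_insert ha,
        Finset.sum_congr rfl fun j hj => (congrArg (· / p) (hJ₁ j hj)).symm]
      have := hfl'
      rw [Finset.sum_congr rfl fun j hj => congrArg (fun x => (x + t j) / p) (hJ₁ j hj)] at this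
      rw [← hP₁] at hfl₁
      omega

/-- **(L4) REDUCTION** (MIZUTANI-PROOF-g59 §7 (L4): "all higher digits to coordinate 1"): in a move-closed
set, from `G` one reaches, for any set `J` of coordinates `∌ a` whose higher digits fit into the
accumulator `a`, the point with `a ↦ G_a + p Σ_{j∈J} ⌊G_j/p⌋`, `j ↦ G_j mod p` on `J`, unchanged
elsewhere; degree and floor are unchanged. [cite: Mizutani1973HironakaGroupSchemes, Remark 2.10 (in-house proof §7 (L4))] -/
theorem exists_reduced {S : Finset (ι →₀ ℕ)} (hS : MoveClosed p q S) (a : ι) :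
    ∀ J : Finset ι, a ∉ J → ∀ G ∈ S, G a + p * ∑ j ∈ J, G j / p < q →
      ∃ P ∈ S, P a = G a + p * ∑ j ∈ J, G j / p ∧ (∀ j ∈ J, P j = G j % p) ∧
        (∀ l, l ≠ a → l ∉ J → P l = G l) ∧ P.degree = G.degree ∧ floorSum p P = floorSum p G := by
  have hp : 0 < p := (Fact.out : p.Prime).pos
  intro J
  induction J using Finset.induction_on with
  | empty =>
    intro _ G hG _
    exact ⟨G, hG, by simp, by simp, fun l _ _ => rfl, rfl, rfl⟩
  | insert b J hb ih =>
    intro haJ G hG hroom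
    rw [Finset.sum_insert hb] at hroom
    have hab : b ≠ a := fun h => haJ (h ▸ Finset.mem_insert_self b J)
    have haJ' : a ∉ J := fun h => haJ (Finset.mem_insert_of_mem h)
    -- move the higher digits `p ⌊G_b/p⌋` of `b` into `a`
    have hleg : LegalMove p q G b a (p * (G b / p)) :=
      ⟨hab, not_dvd_choose_mul_div (G b), by nlinarith [Finset.sum_nonneg (fun j (_ : j ∈ J) => Nat.zero_le (G j / p))]⟩
    set G₁ := move b a (p * (G b / p)) G with hG₁
    have hG₁S : G₁ ∈ S := hS G hG b a _ hleg
    have hb₁ : G₁ b = G b % p := by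
      rw [hG₁, move_apply_source hab]
      have := Nat.div_add_mod (G b) p
      omega
    have ha₁ : G₁ a = G a + p * (G b / p) := move_apply_target hab _ _
    have hoth₁ : ∀ l, l ≠ b → l ≠ a → G₁ l = G l := fun l h1 h2 => move_apply_other h1 h2 _ _
    have hJ₁ : ∀ j ∈ J, G₁ j = G j := fun j hj =>
      hoth₁ j (fun h => hb (h ▸ hj)) (fun h => haJ' (h ▸ hj))
    have hsum₁ : ∑ j ∈ J, G₁ j / p = ∑ j ∈ J, G j / p :=
      Finset.sum_congr rfl fun j hj => by rw [hJ₁ j hj]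
    obtain ⟨P, hPS, hPa, hPJ, hPoth, hPdeg, hPfl⟩ := ih haJ' G₁ hG₁S (by rw [ha₁, hsum₁]; linarith)
    refine ⟨P, hPS, ?_, ?_, ?_, ?_, ?_⟩
    · rw [hPa, ha₁, hsum₁, Finset.sum_insert hb]; ring
    · intro j hj
      rcases Finset.mem_insert.mp hj with rfl | hj
      · rw [hPoth j hab hb, hb₁]
      · rw [hPJ j hj, hJ₁ j hj]
    · intro l hla hl
      rw [hPoth l hla (fun h => hl (Finset.mem_insert_of_mem h)),
        hoth₁ l (fun h => hl (h ▸ Finset.mem_insert_self b J)) hla]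
    · rw [hPdeg, hG₁, degree_move hab (Nat.mul_div_le (G b) p)]
    · rw [hPfl, hG₁, floorSum_move_mul hab le_rfl]

end Pour

end Summit.ResolutionOfSingularities.KangarooAtlas.Mizutani
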